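import Mathlib
import Literature.Computability.AlgebraicComplexity.PartialMatrixMultiplicationProofs
import Literature.Computability.AlgebraicComplexity.FlatteningBound

/-!
# Capacity of rank-`≤ n²` partial matrix multiplications (stub `stub_partialMMCapacity`)

Line `vertex-flattening-factor-rank` for the crux `FidelityWitnesses.DiagonalPowerDecay`
(`stmt-MatrixMultiplication-14053`).

If the partial matrix multiplication `⟨n,n,n⟩_{I,J}` (`partialMatMulTensor ℂ n n n I J`) has tensor
rank `≤ n²`, then its filling is at most `n^{6/ω(ℂ)}`.  This is Schönhage's partial matrix
multiplication theorem (Bürgisser–Clausen–Shokrollahi 1997, Thm. (15.48)), PROVED in the tree as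
`Schonhage1981_partialMatMul_holds`, in its rank form `filling^{ω/3} ≤ R(⟨n,n,n⟩_{I,J})`
(`Schonhage1981_partialMatMul.rank_form`): with `R ≤ n²` we get `f^{ω/3} ≤ n²`, and raising both
(nonnegative) sides to the power `3/ω ≥ 0` (`ω ≥ 2 > 0`, `omega_two_le`) gives
`f = (f^{ω/3})^{3/ω} ≤ (n²)^{3/ω} = n^{6/ω}`.  The case `n = 0` needs no special treatment.
-/

set_option linter.dupNamespace false

namespace Summit.MatrixMultiplication.MatrixMultiplication.Theorems.DiagonalPowerDecay

open Literature.Computability.AlgebraicComplexity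

/-- **Capacity of rank-`≤ n²` partial matrix multiplications** (Schönhage 1981 / BCS Thm. (15.48)).
If `R(⟨n,n,n⟩_{I,J}) ≤ n²` then `filling(I,J) ≤ n^{6/ω(ℂ)}`: from `Schonhage1981_partialMatMul_holds`
(`filling^{ω/3} ≤ R ≤ n²`) by raising to the power `3/ω` (`ω ≥ 2 > 0`, `omega_two_le`). -/
theorem stub_partialMMCapacity :
    ∀ n : ℕ, ∀ I J : Finset (Fin n × Fin n),
      tensorRank (partialMatMulTensor ℂ n n n I J) ≤ n ^ 2 →
        (filling n n n I J : ℝ) ≤ (n : ℝ) ^ (6 / omega ℂ) := by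
  intro n I J hR
  have hω : 2 ≤ omega ℂ := omega_two_le ℂ
  have hωpos : 0 < omega ℂ := by linarith
  have hωne : omega ℂ ≠ 0 := hωpos.ne'
  -- Schönhage's theorem in rank form, combined with the rank hypothesis
  have key : (filling n n n I J : ℝ) ^ (omega ℂ / 3) ≤ ((n : ℝ) ^ (2 : ℕ) : ℝ) := by
    have h1 := Schonhage1981_partialMatMul_holds.rank_form ℂ n n n I J
    have h2 : ((tensorRank (partialMatMulTensor ℂ n n n I J) : ℕ) : ℝ) ≤ ((n ^ 2 : ℕ) : ℝ) := by
      exact_mod_cast hR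
    have h3 : ((n ^ 2 : ℕ) : ℝ) = (n : ℝ) ^ (2 : ℕ) := by push_cast; ring
    linarith [h3 ▸ h2]
  have hf0 : (0 : ℝ) ≤ (filling n n n I J : ℝ) := Nat.cast_nonneg _
  have hn0 : (0 : ℝ) ≤ (n : ℝ) := Nat.cast_nonneg _
  have hexp : (0 : ℝ) ≤ 3 / omega ℂ := div_nonneg (by norm_num) hωpos.le
  -- raise both sides to the power `3/ω`
  have hpow := Real.rpow_le_rpow (Real.rpow_nonneg hf0 _) key hexp
  have lhs : ((filling n n n I J : ℝ) ^ (omega ℂ / 3)) ^ (3 / omega ℂ) = (filling n n n I J : ℝ) := by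
    rw [← Real.rpow_mul hf0]
    have : omega ℂ / 3 * (3 / omega ℂ) = 1 := by field_simp
    rw [this, Real.rpow_one]
  have rhs : ((n : ℝ) ^ (2 : ℕ)) ^ (3 / omega ℂ) = (n : ℝ) ^ (6 / omega ℂ) := by
    rw [← Real.rpow_natCast (n : ℝ) 2, ← Real.rpow_mul hn0]
    congr 1
    push_cast
    ring
  rw [lhs, rhs] at hpow
  exact hpow

end Summit.MatrixMultiplication.MatrixMultiplication.Theorems.DiagonalPowerDecay
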